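import Summits.ABC.IUTFork.Cor312UnionCoverThm311
import HarnessLib

/-!
# [IUTchIII] Cor. 3.12 — the UNION-COVER bed P♮∪ (called P♮ᵤ in parts I–II), V: RIGID CONTROL — under the sign/permutation reading of the
# indeterminacies the Θ-lattice is FIXED, so the union of the possible images is the Θ-region itself and the union level fails too

Proof-only file (D-0012; no definition, no `Prop` fact) of the abc-iut cell (IUT REPAIR branch B, sub-cell B3 Joshi, seat abc-iut-rp-j1 gen 4; rung
LADDER-ABC:A2.RP), sequel of `Cor312UnionCoverShells/Lattice/Model/Thm311` and `Repair/CandJoshi3Union` (the bed P♮∪: plane shells `ℚ²` over `toyIndex`, Ism the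
STABILISER of the log-shell `ℤ²`; the co-rank-one Θ-lattice `thetaLat p j` inside the q-ball `p·Λ_j`; THE COVERING LEMMA: with the basis-mixing `SL₂(ℤ)`-movers the
union of the possible images of the Θ-pilot IS the q-region). TAKES NO SIDE on [IUTchIII] Cor. 3.12 and no side between Mochizuki, Scholze–Stix, Joshi or Dupuy–Hilado.

THE SECOND CONTROL (the first, `CandJoshi3Union.union_translates_ball`, isolated the Θ-SHAPE; this one isolates the READING OF Ism). The bed's one reading choice is
«Ism = the stabiliser of the log-shell» (Dupuy–Hilado's `Aut(K_v;𝓘_v)`). Print's (Ind2) at `𝕍^non` is the action of Galois-induced isometries, which abc-iut-c312-1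
proved RIGID on the log-lattice (`Thm311RealInd2IsmScalar`: a scalar modulo every `n`, no lattice shear); at `𝕍^arc` it is the SIGN group `{±1}` ([IUTchIII] Prop. 1.2
(vii)). The interface-level analogue of that rigid reading on the plane shells is the subgroup generated by the (Ind1) capsule permutations and the SIGN families
(`±1` on every summand of every factor). PROVED HERE, with no new definition (the rigid generators are written as a set-builder):
* `coord_fs_signs` — a sign family acts on every coordinate by the one scalar `∏_i (±1) ∈ {±1}`;
* `rigid_of_mem_closure` — every element `Φ` of the rigid subgroup acts on the coordinates by a SIGNED CAPSULE PERMUTATION: `coord c (Φ x) = s · coord (c ∘ σ) x`,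
  `s ∈ {±1}` (one closure induction);
* **`rigid_image_thetaLat`** — hence `Φ(thetaLat p j) = thetaLat p j` for every such `Φ` (the top coordinate and the q-ball are invariant under signed permutations):
  under the rigid reading the Θ-lattice is (Ind1),(Ind2)-STABLE — rp-h3's `OrbitInside` regime — and **the union of its rigid translates is the Θ-lattice itself**
  (`sUnion_rigid_translates_thetaLat`), which does NOT contain the q-ball at the label `2` (`qBall_not_subset_rigid_union`, witness `p·e_top`: depth `1 < 25 = e_2`).
READING (neutral): together with `CandJoshi3Union.union_translates_ball` this brackets the mechanism of P♮∪ exactly — the union level H_J3 holds on honest data iff BOTH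
the mover group mixes a basis of the log-shell (DH's reading; excluded by print's rigid reading) AND the Θ-region is anisotropic (not the genuine polydisc shape). Which
reading of Ism and which shape describe the genuine IUT data is the dispute resp. the REAL column, untouched here. Interface-level toy; no judgement on print; standard axioms.
[claim: Mochizuki2012, status: disputed] for every IUT noun. [cite: DupuyHilado2020, §4.7, §6.2]
-/

noncomputable section

open Set

namespace Summit.ABC.IUTFork.Cor312Vol

namespace UnionWitness

open Thm311 Cor312 Cor312.Checks Cor312.IdentifiedNonVacuity Literature.IUT.LogThetaLattice

variable (p : ℕ)

/-! ## 15. Sign families act by one sign on every coordinate -/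

/-- The matrix of the identity is the Kronecker delta. [folklore] -/
theorem ent_refl (r b : Bool) : ent (LinearEquiv.refl ℚ (Bool → ℚ)) r b = if r = b then 1 else 0 := by
  unfold ent bvec; simp only [LinearEquiv.refl_apply]; split_ifs with h1 h2 <;> simp_all

/-- The matrix of `−1` is minus the Kronecker delta. [folklore] -/
theorem ent_neg (r b : Bool) : ent (LinearEquiv.neg ℚ : (Bool → ℚ) ≃ₗ[ℚ] (Bool → ℚ)) r b = -(if r = b then 1 else 0) := by
  unfold ent bvec; simp only [LinearEquiv.neg_apply, Pi.neg_apply]; split_ifs with h1 h2 <;> simp_all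

/-- **A SIGN family `⊗_i (±1)` acts on every coordinate by the one scalar `s = ∏_i (±1) ∈ {±1}`** (the print-shaped (Ind2) of the rigid reading: a scalar).
[folklore] -/
theorem coord_fs_signs (j : toyIndex.Label) (vQ : toyIndex.VQ)
    (g : toyIndex.Caps j → ∀ v : toyIndex.Fibre vQ, plane.carrier v.1 ≃ₗ[ℚ] plane.carrier v.1)
    (hg : ∀ i v, g i v = LinearEquiv.refl ℚ _ ∨ g i v = LinearEquiv.neg ℚ) :
    ∃ s : ℚ, (s = 1 ∨ s = -1) ∧ ∀ (c : toyIndex.Caps j → Bool) (x : plane.Packet j vQ),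
      coord j vQ c (plane.factorwise j vQ (fun i => plane.summandwise vQ (g i)) x) = s * coord j vQ c x := by
  -- the sign of the factor `i`
  have hs : ∀ i, ∃ s : ℚ, (s = 1 ∨ s = -1) ∧ ∀ r b, ent (g i (fib0 vQ)) r b = s * (if r = b then 1 else 0) := by
    intro i
    rcases hg i (fib0 vQ) with h | h
    · exact ⟨1, Or.inl rfl, fun r b => by rw [h, ent_refl, one_mul]⟩
    · exact ⟨-1, Or.inr rfl, fun r b => by rw [h, ent_neg, neg_one_mul]⟩
  choose s hs1 hs2 using hs
  refine ⟨∏ i, s i, ?_, fun c x => ?_⟩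
  · -- a product of signs is a sign
    have key : ∀ (t : Finset (toyIndex.Caps j)), (∏ i ∈ t, s i) = 1 ∨ (∏ i ∈ t, s i) = -1 := by
      classical
      intro t
      induction t using Finset.induction_on with
      | empty => exact Or.inl Finset.prod_empty
      | insert a t ha ih =>
        rw [Finset.prod_insert ha]
        rcases hs1 a with h1 | h1 <;> rcases ih with h2 | h2 <;> rw [h1, h2] <;> norm_num
    exact key Finset.univ
  · rw [coord_fs, Finset.sum_eq_single c]
    · simp only [hs2, if_true, mul_one]
    · intro c' _ hc'
      obtain ⟨i, hi⟩ := Function.ne_iff.1 hc'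
      rw [Finset.prod_eq_zero (Finset.mem_univ i) (by rw [hs2, if_neg (Ne.symm hi), mul_zero]), zero_mul]
    · intro h; exact absurd (Finset.mem_univ c) h

/-! ## 16. The rigid subgroup acts by signed capsule permutations; it FIXES the Θ-lattice -/

/-- **Every element of the RIGID subgroup — generated by the (Ind1) capsule permutations and the SIGN families — acts on the coordinates by a SIGNED CAPSULE
PERMUTATION**: `coord c (Φ x) = s · coord (c ∘ σ) x` with `s ∈ {±1}`. [folklore] -/
theorem rigid_of_mem_closure {Φ : plane.PacketAut}
    (hΦ : Φ ∈ Subgroup.closure (plane.Ind1Family ∪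
      {Ψ | ∀ (j : toyIndex.Label) (vQ : toyIndex.VQ), ∃ g : toyIndex.Caps j → ∀ v : toyIndex.Fibre vQ, plane.carrier v.1 ≃ₗ[ℚ] plane.carrier v.1,
        (∀ i v, g i v = LinearEquiv.refl ℚ _ ∨ g i v = LinearEquiv.neg ℚ) ∧ Ψ j vQ = plane.factorwise j vQ (fun i => plane.summandwise vQ (g i))}))
    (j : toyIndex.Label) (vQ : toyIndex.VQ) :
    ∃ (σ : Equiv.Perm (toyIndex.Caps j)) (s : ℚ), (s = 1 ∨ s = -1) ∧
      ∀ (c : toyIndex.Caps j → Bool) (x : plane.Packet j vQ), coord j vQ c (Φ j vQ x) = s * coord j vQ (c ∘ ⇑σ) x := by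
  induction hΦ using Subgroup.closure_induction with
  | mem Ψ hΨ =>
    rcases hΨ with h1 | h2
    · -- (Ind1): a capsule permutation (strip-automorphisms trivial)
      obtain ⟨σ, hh, hmem, hΨ⟩ := h1 j
      refine ⟨σ, 1, Or.inl rfl, fun c x => ?_⟩
      rw [show Ψ j vQ = (plane.permute j vQ σ).trans (plane.factorwise j vQ fun i => plane.summandwise vQ fun v => hh i v.1) from hΨ vQ]
      have hs : (fun i => plane.summandwise vQ fun v => hh i v.1) = fun _ => LinearEquiv.refl ℚ (plane.Packet1 vQ) := by
        funext i
        have : (fun v : toyIndex.Fibre vQ => hh i v.1) = fun v => LinearEquiv.refl ℚ (plane.carrier v.1) := funext fun v => hmem i v.1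
        rw [this]; exact plane.summandwise_refl vQ
      rw [hs, plane.factorwise_refl, one_mul]
      exact coord_permute j vQ σ c x
    · -- a sign family: the identity permutation and one sign
      obtain ⟨g, hg, hΨ⟩ := h2 j vQ
      obtain ⟨s, hs, hsx⟩ := coord_fs_signs j vQ g hg
      exact ⟨Equiv.refl _, s, hs, fun c x => by rw [hΨ, hsx]; rfl⟩
  | one => exact ⟨Equiv.refl _, 1, Or.inl rfl, fun c x => by rw [one_mul]; rfl⟩
  | mul Ψ Ψ' _ _ ih ih' =>
    obtain ⟨σ, s, hs, h⟩ := ih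
    obtain ⟨σ', s', hs', h'⟩ := ih'
    refine ⟨σ'.trans σ, s * s', ?_, fun c x => ?_⟩
    · rcases hs with rfl | rfl <;> rcases hs' with rfl | rfl <;> norm_num
    · show coord j vQ c (Ψ j vQ (Ψ' j vQ x)) = _
      rw [h, h', mul_assoc]; rfl
  | inv Ψ _ ih =>
    obtain ⟨σ, s, hs, h⟩ := ih
    have hs2 : s * s = 1 := by rcases hs with rfl | rfl <;> norm_num
    refine ⟨σ.symm, s, hs, fun c x => ?_⟩
    show coord j vQ c ((Ψ j vQ).symm x) = _
    have h1 := h (c ∘ ⇑σ.symm) ((Ψ j vQ).symm x)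
    rw [LinearEquiv.apply_symm_apply] at h1
    have e : (c ∘ ⇑σ.symm) ∘ ⇑σ = c := funext fun i => by simp
    rw [e] at h1
    calc coord j vQ c ((Ψ j vQ).symm x) = s * s * coord j vQ c ((Ψ j vQ).symm x) := by rw [hs2, one_mul]
      _ = s * coord j vQ (c ∘ ⇑σ.symm) x := by rw [mul_assoc, ← h1]

/-- A signed permutation of the coordinates preserves every ball (depth is read coordinatewise). [folklore] -/
theorem mem_ball_of_signedPerm {j : toyIndex.Label} {vQ : toyIndex.VQ} {Φ : plane.PacketAut} {σ : Equiv.Perm (toyIndex.Caps j)} {s : ℚ}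
    (hs : s = 1 ∨ s = -1) (h : ∀ (c : toyIndex.Caps j → Bool) (x : plane.Packet j vQ), coord j vQ c (Φ j vQ x) = s * coord j vQ (c ∘ ⇑σ) x)
    {k : ℕ} {x : plane.Packet j vQ} (hx : x ∈ ball p j vQ k) : Φ j vQ x ∈ ball p j vQ k := fun c => by
  rw [h]
  rcases hs with rfl | rfl
  · rw [one_mul]; exact hx _
  · exact Deep.intMul ⟨-1, by norm_num⟩ (hx _)

/-- **Under the rigid reading the Θ-lattice is STABLE**: every element of the rigid subgroup carries `thetaLat p j` ONTO itself (the top coordinate `c ≡ true` is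
fixed by every capsule permutation; signs preserve depth). [folklore] -/
theorem rigid_image_thetaLat {Φ : plane.PacketAut}
    (hΦ : Φ ∈ Subgroup.closure (plane.Ind1Family ∪
      {Ψ | ∀ (j : toyIndex.Label) (vQ : toyIndex.VQ), ∃ g : toyIndex.Caps j → ∀ v : toyIndex.Fibre vQ, plane.carrier v.1 ≃ₗ[ℚ] plane.carrier v.1,
        (∀ i v, g i v = LinearEquiv.refl ℚ _ ∨ g i v = LinearEquiv.neg ℚ) ∧ Ψ j vQ = plane.factorwise j vQ (fun i => plane.summandwise vQ (g i))}))
    (j : toyIndex.Label) (vQ : toyIndex.VQ) : Φ j vQ '' thetaLat p j vQ = thetaLat p j vQ := by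
  -- both `Φ` and `Φ⁻¹` lie in the rigid subgroup and act by signed permutations
  have key : ∀ {Ψ : plane.PacketAut}, (∃ (σ : Equiv.Perm (toyIndex.Caps j)) (s : ℚ), (s = 1 ∨ s = -1) ∧
      ∀ (c : toyIndex.Caps j → Bool) (x : plane.Packet j vQ), coord j vQ c (Ψ j vQ x) = s * coord j vQ (c ∘ ⇑σ) x) →
      ∀ x, x ∈ thetaLat p j vQ → Ψ j vQ x ∈ thetaLat p j vQ := by
    rintro Ψ ⟨σ, s, hs, h⟩ x hx
    refine ⟨mem_ball_of_signedPerm p hs h hx.1, ?_⟩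
    show Deep p (eTop j) (coord j vQ (top j) (Ψ j vQ x))
    rw [h, show top j ∘ ⇑σ = top j from rfl]
    rcases hs with rfl | rfl
    · rw [one_mul]; exact hx.2
    · exact Deep.intMul ⟨-1, by norm_num⟩ hx.2
  refine Set.Subset.antisymm (by rintro _ ⟨x, hx, rfl⟩; exact key (rigid_of_mem_closure hΦ j vQ) x hx) fun y hy => ?_
  exact ⟨(Φ j vQ).symm y, key (rigid_of_mem_closure (Subgroup.inv_mem _ hΦ) j vQ) y hy, LinearEquiv.apply_symm_apply _ _⟩

/-- **Hence the UNION of the rigid translates of the Θ-lattice is the Θ-lattice itself** (rp-h3's `OrbitInside` regime, reached by the READING, not the shape).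
[folklore] -/
theorem sUnion_rigid_translates_thetaLat (j : toyIndex.Label) (vQ : toyIndex.VQ) :
    ⋃₀ {U | ∃ Φ ∈ Subgroup.closure (plane.Ind1Family ∪
      {Ψ | ∀ (j : toyIndex.Label) (vQ : toyIndex.VQ), ∃ g : toyIndex.Caps j → ∀ v : toyIndex.Fibre vQ, plane.carrier v.1 ≃ₗ[ℚ] plane.carrier v.1,
        (∀ i v, g i v = LinearEquiv.refl ℚ _ ∨ g i v = LinearEquiv.neg ℚ) ∧ Ψ j vQ = plane.factorwise j vQ (fun i => plane.summandwise vQ (g i))}),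
      U = Φ j vQ '' thetaLat p j vQ} = thetaLat p j vQ := by
  refine Set.Subset.antisymm ?_ fun x hx => ⟨_, ⟨1, Subgroup.one_mem _, (Set.image_id _).symm⟩, hx⟩
  rintro x ⟨_, ⟨Φ, hΦ, rfl⟩, hx⟩
  rwa [rigid_image_thetaLat p hΦ] at hx

/-- **… which does NOT contain the q-ball at the label `2`** (`p` prime): `p·e_top ∈ p·Λ_2` has top depth `1 < 25 = e_2`. So under the rigid (sign/permutation)
reading of the indeterminacies the union level H_J3 FAILS on P♮∪ exactly as READING R3 does — the cover of part III is entirely the work of the basis-mixing movers.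
[folklore] -/
theorem qBall_not_subset_rigid_union [Fact p.Prime] (vQ : toyIndex.VQ) :
    ¬ ball p (2 : toyIndex.Label) vQ 1 ⊆ ⋃₀ {U | ∃ Φ ∈ Subgroup.closure (plane.Ind1Family ∪
      {Ψ | ∀ (j : toyIndex.Label) (vQ : toyIndex.VQ), ∃ g : toyIndex.Caps j → ∀ v : toyIndex.Fibre vQ, plane.carrier v.1 ≃ₗ[ℚ] plane.carrier v.1,
        (∀ i v, g i v = LinearEquiv.refl ℚ _ ∨ g i v = LinearEquiv.neg ℚ) ∧ Ψ j vQ = plane.factorwise j vQ (fun i => plane.summandwise vQ (g i))}),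
      U = Φ (2 : toyIndex.Label) vQ '' thetaLat p 2 vQ} := by
  rw [sUnion_rigid_translates_thetaLat]
  intro h
  have h1 : eTop (2 : toyIndex.Label) ≤ 1 := (ball_subset_thetaLat_iff p 2 vQ 1).1 h
  exact absurd h1 (by decide)

/-- The sign families ARE (Ind2)-families of the plane shells (`−1` stabilises the log-shell), so the rigid subgroup is a subgroup of ⟨(Ind1)∪(Ind2)⟩: the rigid
reading is a RESTRICTION of the bed's reading, not a different interface. [folklore] -/
theorem rigid_le_indGroup :
    Subgroup.closure (plane.Ind1Family ∪
      {Ψ | ∀ (j : toyIndex.Label) (vQ : toyIndex.VQ), ∃ g : toyIndex.Caps j → ∀ v : toyIndex.Fibre vQ, plane.carrier v.1 ≃ₗ[ℚ] plane.carrier v.1,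
        (∀ i v, g i v = LinearEquiv.refl ℚ _ ∨ g i v = LinearEquiv.neg ℚ) ∧ Ψ j vQ = plane.factorwise j vQ (fun i => plane.summandwise vQ (g i))}) ≤
      Subgroup.closure (plane.Ind1Family ∪ plane.Ind2Family) := by
  refine Subgroup.closure_mono (Set.union_subset_union_right _ fun Ψ hΨ j vQ => ?_)
  obtain ⟨g, hg, hΨ⟩ := hΨ j vQ
  refine ⟨g, fun i v => ?_, hΨ⟩
  rcases hg i v with h | h <;> rw [h]
  · exact refl_mem_stab
  · intro y
    simp only [LinearEquiv.neg_apply, Pi.neg_apply]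
    exact ⟨fun hy r => by simpa using (hy r).neg, fun hy r => (hy r).neg⟩

end UnionWitness

end Summit.ABC.IUTFork.Cor312Vol

end
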